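import Literature.AlgebraicGeometry.Resolution.Blowups
import Literature.AlgebraicGeometry.Resolution.ResolutionOfSingularities
import Mathlib.AlgebraicGeometry.IdealSheaf.Subscheme
import Mathlib.RingTheory.Ideal.MinimalPrime.Basic
import HarnessLib

/-!
# Marked ideals, order of an ideal, controlled and strict transforms (BGMW 2011, §§3.1–3.2)

Topic: `Literature/AlgebraicGeometry/Resolution`. DEFINITIONS (with unfolding API) of the basic
objects of the Hironaka–Villamayor–Bierstone–Milman–Włodarczyk resolution algorithm, after
Bierstone–Grigoriev–Milman–Włodarczyk, *Effective Hironaka resolution and its complexity*,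
Asian J. Math. 15 (2011) = arXiv:1206.3090, §3.1 (Defs. 3.1.1–3.1.4) and §3.2 — the vocabulary in
which the standing named fact `BierstoneGrigorievMilmanWlodarczyk2011_embedded`
(`EmbeddedResolution.lean`, BGMW Cor. 8.0.6) decomposes (resolution of marked ideals ⇒
principalization ⇒ embedded desingularization, BGMW §3.3):

* `stalkIdeal I x` — the stalk `I_x ⊆ 𝒪_{X,x}` of a (quasi-coherent) ideal sheaf
  (Mathlib's `Scheme.IdealSheafData` has no stalks); `stalkIdeal_eq_map_germ` (independence of
  the affine neighbourhood), `stalkIdeal_top`, `stalkIdeal_mono`;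
* `idealOrder I x : ℕ∞` — **the order `ord_x(I) = max {i | I_x ⊆ 𝔪_x^i}`** (BGMW §3.1, p. 6);
  `le_idealOrder_iff`, `idealOrder_top`;
* `MarkedIdeal X` — **marked ideals `(X, 𝓘, E, μ)`** (BGMW Def. 3.1.1): an ideal sheaf, a list
  (totally ordered collection) of ideal sheaves of divisors `E`, and `μ : ℕ`;
  `MarkedIdeal.support` — **`supp(𝓘, μ) = {x | ord_x 𝓘 ≥ μ}`** (Def. 3.1.2);
  `MarkedIdeal.support_of_mult_eq_one : supp(𝓘, 1) = supp(𝒪_X/𝓘)` (BGMW Remark (2) after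
  Def. 3.1.2) — PROVED;
* `colon L M` — the colon ideal sheaf `(L : M)`, `le_colon_iff`;
  `controlledTransform σ C I μ` — **the controlled transform `𝓘(D)^{-μ} σ^*(𝓘)`** of BGMW §3.2
  (as the colon `(σ^*𝓘 : 𝓘(D)^μ)`, `D = σ⁻¹(C)` the exceptional divisor);
  `strictTransformIdeal σ C K = ⋃ₙ (σ^*K : 𝓘(D)ⁿ)` — the strict transform of `V(K)`;
  `MarkedIdeal.transform` — Def. 3.1.3 (3)–(5): `(𝓘', E', μ) = (σᶜ(𝓘, μ), σᶜ(E) ∪ {D}, μ)`;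
* `HasSNCWith E C` — `E` has simple normal crossings and `C` has simple normal crossings with `E`
  (local regular systems of parameters adapted to all of them);
* `IsMultipleBlowup M σ M'` (inductive) — **multiple blow-ups of marked ideals** (Defs. 3.1.3
  (1)–(5), 3.1.4): composites of blow-ups with regular [printed: smooth] centres
  `Cᵢ ⊆ supp(𝓘ᵢ, μ)` having snc with `Eᵢ`, transforming the marked ideal as above;
  `IsMarkedResolution` — Def. 3.1.3 (6): … ending with `supp(𝓘_r, μ) = ∅`;
  `IsMarkedResolution.ideal_eq_top` — BGMW §3.3 (1) ⇒ (2), first sentence: a resolution of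
  `(X, 𝓘, ∅, 1)` ends with controlled transform `𝒪_{X_r}` — PROVED.

## Faithfulness notes

* BGMW work with smooth varieties over an algebraically closed field; the definitions are
  rendered for arbitrary schemes, "smooth centre" as `Scheme.IsRegular` of the centre (as in
  `EmbeddedResolution.lean`), and `ord_x` in `ℕ∞` (`⊤` iff `I_x ⊆ ⋂ᵢ 𝔪_xⁱ`, e.g. `I_x = 0`).
* The controlled transform is DEFINED as the colon ideal `(σ^*𝓘 : 𝓘(D)^μ)`; it satisfies
  `𝓘(D)^μ · 𝓘' = σ^*𝓘` exactly when `σ^*𝓘 ⊆ 𝓘(D)^μ` (BGMW Lemma 3.2.1, for `C ⊆ supp(𝓘, μ)`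
  smooth), `𝓘(D)` being invertible — not proved here.
* Isomorphism steps of Def. 3.1.4 ("morphisms which are either isomorphisms or blow-ups") are
  omitted from `IsMultipleBlowup`; they matter only for the bookkeeping of functoriality
  (Def. 3.1.5, "extensions").

## Sources

* [BGMW 2011] §3.1: order `ord_x`, Defs. 3.1.1–3.1.5; §3.2: controlled transform, Lemma 3.2.1;
  §3.3 (1) ⇒ (2) (pp. 6–7, arXiv numbering). [BierstoneGrigorievMilmanWlodarczyk2011]
* U. Görtz, T. Wedhorn, *Algebraic Geometry I*, 2nd ed. (2020), (13.19): strict transform as a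
  schematic closure. [GortzWedhorn2020]
-/

noncomputable section

open CategoryTheory CategoryTheory.Limits AlgebraicGeometry TopologicalSpace IsLocalRing

namespace Literature.AlgebraicGeometry.Resolution

universe u

variable {X : Scheme.{u}}

/-! ## The stalk of an ideal sheaf -/

/-- The **stalk `I_x ⊆ 𝒪_{X,x}`** of the ideal sheaf `I` at `x`: the ideal of the local ring
`𝒪_{X,x}` generated by the germs of the sections of `I` over the affine open neighbourhoods of
`x` (all of which generate the same ideal, `stalkIdeal_eq_map_germ`). [folklore] -/
def stalkIdeal (I : X.IdealSheafData) (x : X) : Ideal (X.presheaf.stalk x) :=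
  ⨆ U : {U : X.affineOpens // x ∈ (U : X.Opens)}, (I.ideal U.1).map (X.presheaf.germ U.1 x U.2).hom

/-- The germs of `I(U)` lie in `I_x`. [folklore] -/
theorem map_germ_le_stalkIdeal (I : X.IdealSheafData) {x : X} (U : X.affineOpens)
    (hx : x ∈ (U : X.Opens)) :
    (I.ideal U).map (X.presheaf.germ U x hx).hom ≤ stalkIdeal I x :=
  le_iSup (fun V : {U : X.affineOpens // x ∈ (U : X.Opens)} =>
    (I.ideal V.1).map (X.presheaf.germ V.1 x V.2).hom) ⟨U, hx⟩

/-- The germs of `I(U)` at `x` only depend on `x`: for affine opens `U, V ∋ x` they generate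
the same ideal of `𝒪_{X,x}` (compare on a common basic open `D(f) = D(g)`, where `I(D(f))` is
generated by the restriction of `I(U)`). [folklore] -/
theorem map_germ_eq_map_germ (I : X.IdealSheafData) {x : X} (U V : X.affineOpens)
    (hU : x ∈ (U : X.Opens)) (hV : x ∈ (V : X.Opens)) :
    (I.ideal U).map (X.presheaf.germ U x hU).hom = (I.ideal V).map (X.presheaf.germ V x hV).hom := by
  obtain ⟨f, g, hfg, hxf⟩ := exists_basicOpen_le_affine_inter U.2 V.2 x ⟨hU, hV⟩
  -- the common basic open `W = D(f) = D(g)`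
  obtain ⟨W, hW⟩ : ∃ W : X.affineOpens, (W : X.Opens) = X.basicOpen f :=
    ⟨⟨_, U.2.basicOpen f⟩, rfl⟩
  have hWU : (W : X.Opens) ≤ U := hW ▸ X.basicOpen_le f
  have hWV : (W : X.Opens) ≤ V := hW ▸ hfg ▸ X.basicOpen_le g
  have hxW : x ∈ (W : X.Opens) := hW ▸ hxf
  -- germs at `x` factor through `W`, and `I(W)` is generated by the restrictions
  have hgU : (X.presheaf.germ U x hU).hom =
      (X.presheaf.germ W x hxW).hom.comp (X.presheaf.map (homOfLE hWU).op).hom := by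
    rw [← CommRingCat.hom_comp, TopCat.Presheaf.germ_res X.presheaf (homOfLE hWU) x hxW]
  have hgV : (X.presheaf.germ V x hV).hom =
      (X.presheaf.germ W x hxW).hom.comp (X.presheaf.map (homOfLE hWV).op).hom := by
    rw [← CommRingCat.hom_comp, TopCat.Presheaf.germ_res X.presheaf (homOfLE hWV) x hxW]
  rw [hgU, hgV, ← Ideal.map_map, ← Ideal.map_map]
  exact congrArg _ ((I.map_ideal hWU).trans (I.map_ideal hWV).symm)

/-- **The stalk is computed on any affine open neighbourhood.** [folklore] -/
theorem stalkIdeal_eq_map_germ (I : X.IdealSheafData) {x : X} (U : X.affineOpens)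
    (hx : x ∈ (U : X.Opens)) :
    stalkIdeal I x = (I.ideal U).map (X.presheaf.germ U x hx).hom := by
  apply le_antisymm
  · exact iSup_le fun V => (map_germ_eq_map_germ I V.1 U V.2 hx).le
  · exact map_germ_le_stalkIdeal I U hx

/-- The stalk of the unit ideal sheaf is the unit ideal. [folklore] -/
theorem stalkIdeal_top (x : X) : stalkIdeal (⊤ : X.IdealSheafData) x = ⊤ := by
  obtain ⟨U, hU, hxU, -⟩ :=
    exists_isAffineOpen_mem_and_subset (X := X) (x := x) (U := ⊤) (Opens.mem_top x)
  rw [stalkIdeal_eq_map_germ ⊤ ⟨U, hU⟩ hxU, Scheme.IdealSheafData.ideal_top, Pi.top_apply,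
    Ideal.map_top]

/-- The stalk is monotone in the ideal sheaf. [folklore] -/
theorem stalkIdeal_mono {I J : X.IdealSheafData} (h : I ≤ J) (x : X) :
    stalkIdeal I x ≤ stalkIdeal J x :=
  iSup_mono fun U => Ideal.map_mono (h U.1)

/-- A point lies in the support of `I` iff `I_x ≠ 𝒪_{X,x}`, i.e. `I_x ⊆ 𝔪_x`. [folklore] -/
theorem mem_support_iff_stalkIdeal_le (I : X.IdealSheafData) (x : X) :
    x ∈ I.support ↔ stalkIdeal I x ≤ maximalIdeal (X.presheaf.stalk x) := by
  obtain ⟨U, hU, hxU, -⟩ :=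
    exists_isAffineOpen_mem_and_subset (X := X) (x := x) (U := ⊤) (Opens.mem_top x)
  rw [Scheme.IdealSheafData.mem_support_iff_of_mem (U := ⟨U, hU⟩) hxU,
    stalkIdeal_eq_map_germ I ⟨U, hU⟩ hxU, Scheme.mem_zeroLocus_iff, Ideal.map_le_iff_le_comap]
  refine forall₂_congr fun f _ => ?_
  rw [X.mem_basicOpen f x hxU, Ideal.mem_comap, IsLocalRing.mem_maximalIdeal, mem_nonunits_iff]

/-! ## The order of an ideal at a point -/

/-- **The order `ord_x(I) := max {i | I_x ⊆ 𝔪_x^i}`** of the ideal sheaf `I` at the point `x`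
(BGMW §3.1, p. 6), valued in `ℕ∞` (`⊤` when `I_x ⊆ 𝔪_xⁱ` for all `i`).
[cite: BierstoneGrigorievMilmanWlodarczyk2011, §3.1 p. 6] -/
def idealOrder (I : X.IdealSheafData) (x : X) : ℕ∞ :=
  ⨆ i : {i : ℕ // stalkIdeal I x ≤ maximalIdeal (X.presheaf.stalk x) ^ i}, (i.1 : ℕ∞)

/-- `ord_x(I) ≥ n` iff `I_x ⊆ 𝔪_xⁿ`. [cite: BierstoneGrigorievMilmanWlodarczyk2011, §3.1 p. 6] -/
theorem le_idealOrder_iff (I : X.IdealSheafData) (x : X) (n : ℕ) :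
    (n : ℕ∞) ≤ idealOrder I x ↔ stalkIdeal I x ≤ maximalIdeal (X.presheaf.stalk x) ^ n := by
  constructor
  · intro h
    by_contra hn
    -- every admissible `i` is `< n`, so the supremum is `≤ n - 1 < n`
    have hlt : ∀ i : {i : ℕ // stalkIdeal I x ≤ maximalIdeal (X.presheaf.stalk x) ^ i},
        i.1 < n := by
      intro i
      by_contra hi
      exact hn (i.2.trans (Ideal.pow_le_pow_right (not_lt.mp hi)))
    have hn0 : n ≠ 0 := by
      rintro rfl
      exact hn (by rw [pow_zero, Ideal.one_eq_top]; exact le_top)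
    have : idealOrder I x ≤ ((n - 1 : ℕ) : ℕ∞) :=
      iSup_le fun i => by exact_mod_cast Nat.le_sub_one_of_lt (hlt i)
    have h' : n ≤ n - 1 := by exact_mod_cast h.trans this
    omega
  · intro h
    exact le_iSup (fun i : {i : ℕ // stalkIdeal I x ≤ maximalIdeal (X.presheaf.stalk x) ^ i} =>
      (i.1 : ℕ∞)) ⟨n, h⟩

/-- The unit ideal sheaf has order `0` everywhere. [folklore] -/
theorem idealOrder_top (x : X) : idealOrder (⊤ : X.IdealSheafData) x = 0 := by
  refine le_antisymm (iSup_le fun i => ?_) bot_le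
  obtain ⟨i, hi⟩ := i
  rw [stalkIdeal_top, top_le_iff] at hi
  cases i with
  | zero => simp
  | succ k =>
    exact absurd (top_le_iff.mp (hi ▸ Ideal.pow_le_self (Nat.succ_ne_zero k)))
      (maximalIdeal.isMaximal (X.presheaf.stalk x)).ne_top

/-- `ord_x(I) ≥ 1` iff `x ∈ supp(𝒪_X/I)`. [folklore] -/
theorem one_le_idealOrder_iff (I : X.IdealSheafData) (x : X) :
    1 ≤ idealOrder I x ↔ x ∈ I.support := by
  rw [mem_support_iff_stalkIdeal_le, ← pow_one (maximalIdeal _)]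
  exact_mod_cast le_idealOrder_iff I x 1

/-! ## Marked ideals and their supports -/

variable (X) in
/-- **A marked ideal `(X, 𝓘, E, μ)`** (BGMW Def. 3.1.1, after Hironaka, Bierstone–Milman and
Villamayor's "basic objects"): an ideal sheaf `𝓘` on `X`, a totally ordered collection `E` of
divisors (here: the list of their ideal sheaves; BGMW require their components pairwise disjoint,
of multiplicity one and with simultaneous simple normal crossings — conditions imposed where
used, `HasSNCWith`), and a nonnegative integer `μ`. (BGMW: `X` a smooth variety.)
[cite: BierstoneGrigorievMilmanWlodarczyk2011, Def. 3.1.1] -/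
structure MarkedIdeal where
  /-- the ideal sheaf `𝓘` -/
  ideal : X.IdealSheafData
  /-- the boundary `E`: an ordered list of ideal sheaves of divisors -/
  boundary : List X.IdealSheafData
  /-- the multiplicity `μ` -/
  mult : ℕ

namespace MarkedIdeal

/-- **The support `supp(X, 𝓘, E, μ) := {x ∈ X | ord_x(𝓘) ≥ μ}`** (BGMW Def. 3.1.2, originally
"singular locus"). [cite: BierstoneGrigorievMilmanWlodarczyk2011, Def. 3.1.2] -/
def support (M : MarkedIdeal X) : Set X :=
  {x | (M.mult : ℕ∞) ≤ idealOrder M.ideal x}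

/-- Membership in the support. [folklore] -/
theorem mem_support_iff (M : MarkedIdeal X) (x : X) :
    x ∈ M.support ↔ stalkIdeal M.ideal x ≤ maximalIdeal (X.presheaf.stalk x) ^ M.mult :=
  le_idealOrder_iff _ _ _

/-- **`supp(𝓘, 1) = supp(𝒪_X/𝓘)`** (BGMW Remark (2) after Def. 3.1.2). In particular the support
of a marked ideal of multiplicity one is closed.
[cite: BierstoneGrigorievMilmanWlodarczyk2011, §3.1 Remark (2)] -/
theorem support_of_mult_eq_one (M : MarkedIdeal X) (h : M.mult = 1) :
    M.support = (M.ideal.support : Set X) := by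
  ext x
  change (M.mult : ℕ∞) ≤ idealOrder M.ideal x ↔ x ∈ M.ideal.support
  rw [h, Nat.cast_one, one_le_idealOrder_iff]

/-- A marked ideal of multiplicity `0` has full support. [folklore] -/
theorem support_of_mult_eq_zero (M : MarkedIdeal X) (h : M.mult = 0) : M.support = Set.univ := by
  ext x
  simp [support, h]

end MarkedIdeal

/-! ## Colon ideal sheaves; controlled and strict transforms under a blow-up -/

/-- The **colon ideal sheaf `(L : M)`**: the largest ideal sheaf `K` with `M · K ⊆ L`.
[folklore] -/
def colon (L M : X.IdealSheafData) : X.IdealSheafData :=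
  sSup {K | M * K ≤ L}

/-- Multiplication of ideal sheaves distributes over suprema. [folklore] -/
theorem mul_sSup_le_iff (M L : X.IdealSheafData) (S : Set X.IdealSheafData) :
    M * sSup S ≤ L ↔ ∀ K ∈ S, M * K ≤ L := by
  constructor
  · intro h K hK
    exact (show M * K ≤ M * sSup S from fun U => Ideal.mul_mono_right (le_sSup hK U)).trans h
  · intro h U
    change (M * sSup S).ideal U ≤ L.ideal U
    rw [Scheme.IdealSheafData.ideal_mul, Pi.mul_apply, sSup_eq_iSup',
      Scheme.IdealSheafData.ideal_iSup, iSup_apply, Ideal.mul_iSup]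
    exact iSup_le fun K => h K.1 K.2 U

/-- **Adjunction for the colon ideal sheaf**: `K ⊆ (L : M) ↔ M · K ⊆ L`. [folklore] -/
theorem le_colon_iff {K L M : X.IdealSheafData} : K ≤ colon L M ↔ M * K ≤ L := by
  constructor
  · intro h
    refine (show M * K ≤ M * colon L M from fun U => Ideal.mul_mono_right (h U)).trans ?_
    exact (mul_sSup_le_iff M L _).mpr fun K hK => hK
  · intro h
    exact le_sSup h

/-- `M · (L : M) ⊆ L`. [folklore] -/
theorem mul_colon_le (L M : X.IdealSheafData) : M * colon L M ≤ L :=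
  le_colon_iff.mp le_rfl

/-- `L ⊆ (L : M)`. [folklore] -/
theorem le_colon_self (L M : X.IdealSheafData) : L ≤ colon L M :=
  le_colon_iff.mpr fun _ => Ideal.mul_le_left

/-- The colon ideal sheaf is monotone in its first argument. [folklore] -/
theorem colon_mono_left {L L' : X.IdealSheafData} (h : L ≤ L') (M : X.IdealSheafData) :
    colon L M ≤ colon L' M :=
  le_colon_iff.mpr ((mul_colon_le L M).trans h)

/-- `(L : ⊤) = L`. [folklore] -/
theorem colon_top (L : X.IdealSheafData) : colon L ⊤ = L :=
  le_antisymm (by simpa using mul_colon_le L ⊤) (le_colon_self L ⊤)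

variable {X' : Scheme.{u}} (σ : X' ⟶ X) (C : X.IdealSheafData)

/-- **The controlled transform `σᶜ(𝓘, μ) = 𝓘(D)^{-μ} σ^*(𝓘)`** of the ideal sheaf `𝓘` with
multiplicity `μ` under the blow-up `σ : X' → X` with centre `V(C)` and exceptional divisor
`D = σ⁻¹(V(C))` (ideal `𝓘(D) = σ⁻¹C · 𝒪_{X'}`), BGMW §3.2 / Def. 3.1.3 (3), rendered as the colon
ideal sheaf `(σ^*𝓘 : 𝓘(D)^μ)` (equal to the printed quotient when `σ^*𝓘 ⊆ 𝓘(D)^μ`, BGMW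
Lemma 3.2.1, `𝓘(D)` being invertible). [cite: BierstoneGrigorievMilmanWlodarczyk2011, §3.2] -/
def controlledTransform (I : X.IdealSheafData) (μ : ℕ) : X'.IdealSheafData :=
  colon (I.comap σ) ((C.comap σ) ^ μ)

/-- `𝓘(D)^μ · σᶜ(𝓘, μ) ⊆ σ^*(𝓘)`. [folklore] -/
theorem pow_mul_controlledTransform_le (I : X.IdealSheafData) (μ : ℕ) :
    (C.comap σ) ^ μ * controlledTransform σ C I μ ≤ I.comap σ :=
  mul_colon_le _ _

/-- `σ^*(𝓘) ⊆ σᶜ(𝓘, μ)` (the controlled transform contains the total transform). [folklore] -/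
theorem comap_le_controlledTransform (I : X.IdealSheafData) (μ : ℕ) :
    I.comap σ ≤ controlledTransform σ C I μ :=
  le_colon_self _ _

/-- With multiplicity `0` the controlled transform is the total transform `σ^*(𝓘)`. [folklore] -/
theorem controlledTransform_zero (I : X.IdealSheafData) : controlledTransform σ C I 0 = I.comap σ := by
  rw [controlledTransform, pow_zero, Scheme.IdealSheafData.one_eq_top, colon_top]

/-- **The strict transform of the closed subscheme `V(K)`** under the blow-up `σ` with
exceptional divisor `D`: the closed subscheme of `X'` with ideal `⋃ₙ (σ^*K : 𝓘(D)ⁿ)` — the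
schematic closure of `σ⁻¹(V(K) ∖ V(C))` in `X'` (Görtz–Wedhorn I, (13.19): the strict transform
"can also be described as the schematic closure of `π⁻¹(Y ∖ Z)`"); used for the divisors of `E`
(BGMW Def. 3.1.3 (4): `Eᵢ = σᵢᶜ(E_{i-1}) ∪ {Dᵢ}`). [cite: GortzWedhorn2020, (13.19) p. 414] -/
def strictTransformIdeal (K : X.IdealSheafData) : X'.IdealSheafData :=
  ⨆ n : ℕ, colon (K.comap σ) ((C.comap σ) ^ n)

/-- The strict transform contains every controlled transform. [folklore] -/
theorem controlledTransform_le_strictTransformIdeal (K : X.IdealSheafData) (μ : ℕ) :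
    controlledTransform σ C K μ ≤ strictTransformIdeal σ C K :=
  le_iSup (fun n : ℕ => colon (K.comap σ) ((C.comap σ) ^ n)) μ

namespace MarkedIdeal

/-- **The transform of a marked ideal** under the blow-up `σ : X' → X` with centre `V(C)`
(BGMW Def. 3.1.3 (3)–(5) and §3.2): `𝓘' = 𝓘(D)^{-μ} σ^*(𝓘)` (controlled transform),
`E' = σᶜ(E) ∪ {D}` (strict transforms of the old divisors, in the old order, followed by the
exceptional divisor `D` as the maximal element), same `μ`.
[cite: BierstoneGrigorievMilmanWlodarczyk2011, Def. 3.1.3 (3)–(5)] -/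
def transform (M : MarkedIdeal X) : MarkedIdeal X' where
  ideal := controlledTransform σ C M.ideal M.mult
  boundary := M.boundary.map (strictTransformIdeal σ C) ++ [C.comap σ]
  mult := M.mult

/-- Unfolding the ideal of the transform. [folklore] -/
@[simp] theorem transform_ideal (M : MarkedIdeal X) :
    (M.transform σ C).ideal = controlledTransform σ C M.ideal M.mult := rfl

/-- Unfolding the boundary of the transform. [folklore] -/
@[simp] theorem transform_boundary (M : MarkedIdeal X) :
    (M.transform σ C).boundary = M.boundary.map (strictTransformIdeal σ C) ++ [C.comap σ] := rfl

/-- Unfolding the multiplicity of the transform. [folklore] -/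
@[simp] theorem transform_mult (M : MarkedIdeal X) : (M.transform σ C).mult = M.mult := rfl

end MarkedIdeal

/-! ## Simple normal crossings -/

/-- **`E` has (simultaneous) simple normal crossings and `C` has simple normal crossings with
`E`** (the conditions of BGMW Def. 3.1.1 on `E` and Def. 3.1.3 (2) on the centre): at every
point `x`, the local ring `𝒪_{X,x}` is regular and admits a regular system of parameters
`u_1, …, u_d` (`d = emb dim`) such that each divisor of `E` through `x` has stalk ideal `(u_i)`
for some `i` (distinct divisors getting distinct parameters) and, if `x ∈ V(C)`, the stalk of
`C` is generated by a subset of the `u_i`. [cite: BierstoneGrigorievMilmanWlodarczyk2011, Def. 3.1.1 and Def. 3.1.3 (2)] -/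
def HasSNCWith (E : List X.IdealSheafData) (C : X.IdealSheafData) : Prop :=
  ∀ x : X, IsRegularLocalRing (X.presheaf.stalk x) ∧
    ∃ u : Fin (maximalIdeal (X.presheaf.stalk x)).spanFinrank → X.presheaf.stalk x,
      Ideal.span (Set.range u) = maximalIdeal (X.presheaf.stalk x) ∧
      (∃ ι : {D // D ∈ E ∧ x ∈ D.support} → Fin (maximalIdeal (X.presheaf.stalk x)).spanFinrank,
        Function.Injective ι ∧ ∀ D, stalkIdeal D.1 x = Ideal.span {u (ι D)}) ∧
      (x ∈ C.support → ∃ S : Set (Fin (maximalIdeal (X.presheaf.stalk x)).spanFinrank),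
        stalkIdeal C x = Ideal.span (u '' S))

/-- `E` has simple normal crossings: `HasSNCWith E ⊤` (no centre). [folklore] -/
abbrev HasSNC (E : List X.IdealSheafData) : Prop :=
  HasSNCWith E ⊤

/-! ## Multiple blow-ups and resolutions of marked ideals -/

/-- **Multiple blow-up of a marked ideal** (BGMW Def. 3.1.3 (1)–(5) with Def. 3.1.4):
`IsMultipleBlowup M σ M'` says that `σ : X' → X` is a composite of finitely many blow-ups
`X' = X_r → ⋯ → X_0 = X`, the `i`-th along an ideal sheaf `Cᵢ` of `Xᵢ` whose centre `V(Cᵢ)` is a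
regular scheme [printed: smooth], is contained in `supp(Xᵢ, 𝓘ᵢ, Eᵢ, μ)` (1) and has simple
normal crossings with `Eᵢ` (2), and that `M' = (X_r, 𝓘_r, E_r, μ)` is obtained from
`M = (X, 𝓘, E, μ)` by the successive transforms (3)–(5) (`MarkedIdeal.transform`). Generated by
the empty sequence and post-composition with one more blow-up.
[cite: BierstoneGrigorievMilmanWlodarczyk2011, Def. 3.1.3 and Def. 3.1.4] -/
inductive IsMultipleBlowup : MarkedIdeal X → ∀ ⦃X' : Scheme.{u}⦄, (X' ⟶ X) → MarkedIdeal X' → Prop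
  /-- the empty sequence -/
  | refl (M : MarkedIdeal X) : IsMultipleBlowup M (𝟙 X) M
  /-- one more blow-up `τ : X'' → X'` with regular centre `V(C) ⊆ supp(M')` having snc with the
  boundary of `M'` -/
  | blowup {M : MarkedIdeal X} ⦃X' X'' : Scheme.{u}⦄ {σ : X' ⟶ X} {M' : MarkedIdeal X'}
      (h : IsMultipleBlowup M σ M') (C : X'.IdealSheafData) (τ : X'' ⟶ X') (hτ : IsBlowup τ C)
      (hC : Scheme.IsRegular C.subscheme) (hsupp : (C.support : Set X') ⊆ M'.support)
      (hsnc : HasSNCWith M'.boundary C) :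
      IsMultipleBlowup M (τ ≫ σ) (M'.transform τ C)

/-- **Resolution of a marked ideal** (BGMW Def. 3.1.3): a multiple blow-up ending with
`supp(X_r, 𝓘_r, E_r, μ) = ∅` (condition (6)).
[cite: BierstoneGrigorievMilmanWlodarczyk2011, Def. 3.1.3] -/
def IsMarkedResolution (M : MarkedIdeal X) ⦃X' : Scheme.{u}⦄ (σ : X' ⟶ X) (M' : MarkedIdeal X') :
    Prop :=
  IsMultipleBlowup M σ M' ∧ M'.support = ∅

namespace IsMultipleBlowup

/-- A single blow-up with admissible centre is a multiple blow-up. [folklore] -/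
theorem single (M : MarkedIdeal X) (C : X.IdealSheafData) {X' : Scheme.{u}} (τ : X' ⟶ X)
    (hτ : IsBlowup τ C) (hC : Scheme.IsRegular C.subscheme)
    (hsupp : (C.support : Set X) ⊆ M.support) (hsnc : HasSNCWith M.boundary C) :
    IsMultipleBlowup M τ (M.transform τ C) := by
  simpa using IsMultipleBlowup.blowup (IsMultipleBlowup.refl M) C τ hτ hC hsupp hsnc

/-- The multiplicity is unchanged along a multiple blow-up. [folklore] -/
theorem mult_eq {M : MarkedIdeal X} {X' : Scheme.{u}} {σ : X' ⟶ X} {M' : MarkedIdeal X'}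
    (h : IsMultipleBlowup M σ M') : M'.mult = M.mult := by
  induction h with
  | refl => rfl
  | blowup _ C τ _ _ _ _ ih => exact ih

end IsMultipleBlowup

/-- A marked ideal with empty support is resolved by the empty sequence. [folklore] -/
theorem isMarkedResolution_refl {M : MarkedIdeal X} (h : M.support = ∅) :
    IsMarkedResolution M (𝟙 X) M :=
  ⟨IsMultipleBlowup.refl M, h⟩

/-- **BGMW §3.3, (1) ⇒ (2), first step**: a resolution of `(X, 𝓘, E, 1)` ends with controlled
transform `𝓘_r = 𝒪_{X_r}` ("The controlled transform `(𝓘~, 1) := σᶜ(𝓘, 1)` has the empty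
support. Consequently, `V(𝓘~) = ∅`, and thus `𝓘~` is equal to the structural sheaf").
[cite: BierstoneGrigorievMilmanWlodarczyk2011, §3.3 (1)⇒(2)] -/
theorem IsMarkedResolution.ideal_eq_top {M : MarkedIdeal X} (hM : M.mult = 1) {X' : Scheme.{u}}
    {σ : X' ⟶ X} {M' : MarkedIdeal X'} (h : IsMarkedResolution M σ M') : M'.ideal = ⊤ := by
  have h1 : M'.mult = 1 := h.1.mult_eq.trans hM
  have h2 := M'.support_of_mult_eq_one h1
  rw [h.2] at h2
  rw [← Scheme.IdealSheafData.support_eq_bot_iff]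
  ext x
  simpa using (Set.ext_iff.mp h2 x)

end Literature.AlgebraicGeometry.Resolution

end
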